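import Summits.QuantumFields.YangMills.Theorems.SwapVirialDeficitBlowUpScaling
import Summits.QuantumFields.YangMills.Theorems.SwapVirialDeficitBlowUpLeaderDominator
import Summits.QuantumFields.YangMills.Theorems.SwapVirialDeficitGnomonicDilation
import HarnessLib

/-!
# GNOMONIC LETTERS for the joint blow-up (file G0 of the virial programme, memo2-24197-window v2 §2′;
# free-hands support of ⟨stmt-QuantumFields-24197⟩ `SwapVirialDeficit.SwapGluedStiffness`)

The blow-up space `B = ℍ × (((ℍ×ℍ)×ℍ) × (Fol L → ℍ))` of ✓`blowUpPoint` is fed with GNOMONIC letters `±(1, v)`, `v ∈ ℝ³`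
(✓`Literature…SU2HaarChart.gnomonicQuat`): no new chart map is needed, and the blow-up dilation becomes LINEAR on the coordinates.
* §1 `gnoLetter ε v := (±1) • gnomonicQuat v`, `GnoCoord L`, `GnoSign L`, `gnomonicPoint a ε η : B`, `trDil t v := (v₀, t v₁, t v₂)`, `eulerDilate t η`
  (letters `x, y`: only the `J, K` components are dilated — ✓`dilate` fixes `re, imI`; letter `z` and the followers: all three — ✓`dilateIm`);
* §2 `dilate_gnoLetter`, `dilateIm_gnoLetter`, ★ `blowUpPoint_gnomonicPoint : blowUpPoint t (gnomonicPoint a ε η) = blowUpPoint 1 (gnomonicPoint a ε (eulerDilate t η))`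
  — THE BLOW-UP IS THE EULER DILATION of the gnomonic coordinates (dilated dimension `2+2+3+3·|Fol L| = 18L⁴ − 2 = 2α`);
* §3 non-degeneracy for free: `gnoLetter_re_ne_zero`, `axPart_gnoLetter_ne_zero`, `gnoLetter_ne_zero`; `contDiff_gnoLetter`,
  measurability `measurable_gnomonicPoint`;
* §4 the density and the Euler weight ON TOP OF w2 g57's ✓`…SwapVirialDeficitGnomonicDilation` (`Gnomonic.gnomonicWeight`, `gnomonicW`, `piWeight`):
  `gnoDensity η`, transverse weight `gnoWtr`, `gnoW η` (`0 ≤ gnoW ≤ 4·(3 + |Fol L|)`).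
HONEST LABEL: definitions and algebra only; nothing about ⟨24197⟩ or any rung is proved; the Yang–Mills mass gap is NOT proved; no summit is proved by a
line.  Seat ym-line-fcl-p3 g45 (cell ym-idea-1, free hands; item of record ⟨24085⟩ aside, untouched), `--supports stmt-QuantumFields-24197`.
0 `sorry`, standard axioms; the series' local `ℍ` instances.  References: [folklore].
-/

set_option autoImplicit false

noncomputable section

open MeasureTheory Quaternion Set
open scoped Quaternion BigOperators
open Literature.MathematicalPhysics.QuantumLattice
open Literature.MathematicalPhysics.QuantumFieldTheory hiding SU2
open Summit.QuantumFields.YangMills.Theorems.SwapTwistDeficit.ToronLog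

attribute [local instance] Literature.Analysis.FluidPDE.Tao2016.quatMeasurableSpace
  Literature.Analysis.FluidPDE.Tao2016.quatBorelSpace
  Literature.MathematicalPhysics.QuantumLattice.secondCountableTopology_su2

namespace Summit.QuantumFields.YangMills.Theorems.SwapVirialDeficit.BlowUpRing

open Summit.QuantumFields.YangMills.Theorems.FemtoTransferGap
open Summit.QuantumFields.YangMills.Theorems.SwapVirialDeficit.ZeroModeGroup (dilate dilate_apply)
open Summit.QuantumFields.YangMills.Theorems.SwapVirialDeficit.ZeroModeSigma (dil3 dil3_apply dilateIm dilateIm_apply axPart)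
open Summit.QuantumFields.YangMills.Theorems.SwapVirialDeficit.BlowUp (leaderTuple dil3_one' dilateIm_one_apply)
open Summit.QuantumFields.YangMills.Theorems.SwapVirialDeficit.Gnomonic (gnomonicWeight gnomonicW piWeight gnomonicW_nonneg_le)

variable {L : ℕ} [NeZero L]

/-! ## §1 Gnomonic letters and coordinates -/

/-- A GNOMONIC LETTER: the quaternion `±(1, v)` of the hemisphere `ε` over `v ∈ ℝ³` (its radial projection is the group element). [folklore] -/
def gnoLetter (ε : Bool) (v : Fin 3 → ℝ) : ℍ := (if ε then (1 : ℝ) else -1) • gnomonicQuat v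

/-- The sign of a hemisphere, as a real number `±1`. [folklore] -/
def gnoSign (ε : Bool) : ℝ := if ε then (1 : ℝ) else -1

/-- `gnoLetter ε v = gnoSign ε • gnomonicQuat v`. [folklore] -/
theorem gnoLetter_eq (ε : Bool) (v : Fin 3 → ℝ) : gnoLetter ε v = gnoSign ε • gnomonicQuat v := rfl

/-- `gnoSign ε ≠ 0`. [folklore] -/
theorem gnoSign_ne_zero (ε : Bool) : gnoSign ε ≠ 0 := by
  cases ε <;> simp [gnoSign]

/-- `gnoSign ε ^ 2 = 1`. [folklore] -/
theorem gnoSign_sq (ε : Bool) : gnoSign ε ^ 2 = 1 := by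
  cases ε <;> simp [gnoSign]

variable (L) in
/-- GNOMONIC COORDINATES of the blow-up space: the three free leader letters `x, y, z` and the followers, each in `ℝ³`. [folklore] -/
abbrev GnoCoord : Type := ((Fin 3 → ℝ) × (Fin 3 → ℝ)) × (Fin 3 → ℝ) × (Fol L → Fin 3 → ℝ)

variable (L) in
/-- HEMISPHERE SIGNS of the letters. [folklore] -/
abbrev GnoSign : Type := (Bool × Bool) × Bool × (Fol L → Bool)

/-- The point of the blow-up space with hub `a`, hemisphere signs `ε` and gnomonic coordinates `η`. [folklore] -/
def gnomonicPoint (a : ℍ) (ε : GnoSign L) (η : GnoCoord L) : ℍ × (((ℍ × ℍ) × ℍ) × (Fol L → ℍ)) :=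
  (a, (((gnoLetter ε.1.1 η.1.1, gnoLetter ε.1.2 η.1.2), gnoLetter ε.2.1 η.2.1), fun f => gnoLetter (ε.2.2 f) (η.2.2 f)))

/-- The TRANSVERSE dilation of a leader letter's gnomonic coordinates: `(v₀, v₁, v₂) ↦ (v₀, t v₁, t v₂)`. [folklore] -/
def trDil (t : ℝ) (v : Fin 3 → ℝ) : Fin 3 → ℝ := ![v 0, t * v 1, t * v 2]

/-- `trDil 1 = id`. [folklore] -/
@[simp] theorem trDil_one (v : Fin 3 → ℝ) : trDil 1 v = v := by
  ext i; fin_cases i <;> simp [trDil]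

/-- THE EULER DILATION of the gnomonic coordinates (= the blow-up, §2): transverse on `x, y`, full on `z` and the followers. [folklore] -/
def eulerDilate (t : ℝ) (η : GnoCoord L) : GnoCoord L :=
  ((trDil t η.1.1, trDil t η.1.2), t • η.2.1, fun f => t • η.2.2 f)

/-! ## §2 The blow-up is the Euler dilation -/

/-- `dilate t (±(1, v)) = ±(1, trDil t v)`. [folklore] -/
theorem dilate_gnoLetter (t : ℝ) (ε : Bool) (v : Fin 3 → ℝ) : dilate t (gnoLetter ε v) = gnoLetter ε (trDil t v) := by
  rw [gnoLetter_eq, gnoLetter_eq, map_smul]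
  congr 1
  rw [dilate_apply]
  ext <;> simp [gnomonicQuat, trDil]

/-- `dilateIm t (±(1, v)) = ±(1, t•v)`. [folklore] -/
theorem dilateIm_gnoLetter (t : ℝ) (ε : Bool) (v : Fin 3 → ℝ) : dilateIm t (gnoLetter ε v) = gnoLetter ε (t • v) := by
  rw [gnoLetter_eq, gnoLetter_eq, map_smul]
  congr 1
  rw [dilateIm_apply]
  ext <;> simp [gnomonicQuat]

omit [NeZero L] in
/-- ★ **THE BLOW-UP IS THE EULER DILATION OF THE GNOMONIC COORDINATES**:
`blowUpPoint t (gnomonicPoint a ε η) = blowUpPoint 1 (gnomonicPoint a ε (eulerDilate t η))`. [folklore] -/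
theorem blowUpPoint_gnomonicPoint (t : ℝ) (a : ℍ) (ε : GnoSign L) (η : GnoCoord L) :
    blowUpPoint (L := L) t (gnomonicPoint a ε η) = blowUpPoint (L := L) 1 (gnomonicPoint a ε (eulerDilate t η)) := by
  simp only [blowUpPoint, gnomonicPoint, eulerDilate, dil3_apply, dilate_gnoLetter, dilateIm_gnoLetter, trDil_one, one_smul]

omit [NeZero L] in
/-- The Euler dilations compose: `eulerDilate t (eulerDilate s η) = eulerDilate (t * s) η`. [folklore] -/
theorem eulerDilate_eulerDilate (t s : ℝ) (η : GnoCoord L) : eulerDilate t (eulerDilate s η) = eulerDilate (t * s) η := by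
  simp only [eulerDilate, smul_smul]
  refine Prod.ext (Prod.ext ?_ ?_) (Prod.ext rfl rfl)
  · ext i; fin_cases i <;> simp [trDil, mul_assoc]
  · ext i; fin_cases i <;> simp [trDil, mul_assoc]

omit [NeZero L] in
/-- `eulerDilate 1 = id`. [folklore] -/
theorem eulerDilate_one (η : GnoCoord L) : eulerDilate 1 η = η := by
  simp only [eulerDilate, one_smul]
  refine Prod.ext (Prod.ext ?_ ?_) (Prod.ext rfl rfl)
  · ext i; fin_cases i <;> simp [trDil]
  · ext i; fin_cases i <;> simp [trDil]

/-! ## §3 Non-degeneracy and measurability -/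

/-- `(gnoLetter ε v).re = ±1 ≠ 0`. [folklore] -/
theorem gnoLetter_re (ε : Bool) (v : Fin 3 → ℝ) : (gnoLetter ε v).re = gnoSign ε := by
  rw [gnoLetter_eq]
  simp [gnomonicQuat]

/-- `(gnoLetter ε v).re ≠ 0`. [folklore] -/
theorem gnoLetter_re_ne_zero (ε : Bool) (v : Fin 3 → ℝ) : (gnoLetter ε v).re ≠ 0 := by
  rw [gnoLetter_re]; exact gnoSign_ne_zero ε

/-- `gnoLetter ε v ≠ 0`. [folklore] -/
theorem gnoLetter_ne_zero (ε : Bool) (v : Fin 3 → ℝ) : gnoLetter ε v ≠ 0 := fun h =>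
  gnoLetter_re_ne_zero ε v (by rw [h]; rfl)

/-- `axPart (gnoLetter ε v) ≠ 0` (its real part is `±1`). [folklore] -/
theorem axPart_gnoLetter_ne_zero (ε : Bool) (v : Fin 3 → ℝ) : axPart (gnoLetter ε v) ≠ 0 := by
  intro h
  have h' := congrArg (fun q : ℍ => q.re) h
  simp only [axPart] at h'
  exact gnoLetter_re_ne_zero ε v (by simpa using h')

/-- (private copy; the public survivor is ✓`Literature.MathematicalPhysics.QuantumFieldTheory.Balaban1983to89.T4WilsonPathInsert.contDiff_gnomonicQuat`,
whose import closure is too heavy for this root file) `v ↦ (1, v)` is smooth. [folklore] -/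
private theorem contDiff_gnomonicQuat' {n : WithTop ℕ∞} : ContDiff ℝ n (gnomonicQuat : (Fin 3 → ℝ) → ℍ) := by
  let e : ℍ ≃L[ℝ] (Fin 4 → ℝ) := LinearEquiv.toContinuousLinearEquiv (QuaternionAlgebra.linearEquivTuple (-1 : ℝ) (0 : ℝ) (-1 : ℝ))
  have h : (gnomonicQuat : (Fin 3 → ℝ) → ℍ) = fun v => e.symm ![1, v 0, v 1, v 2] := by
    funext v
    apply e.injective
    rw [ContinuousLinearEquiv.apply_symm_apply]
    ext i
    fin_cases i <;> rfl
  rw [h]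
  refine e.symm.contDiff.comp (contDiff_pi.2 fun i => ?_)
  fin_cases i
  · exact contDiff_const
  · exact contDiff_apply ℝ ℝ (0 : Fin 3)
  · exact contDiff_apply ℝ ℝ (1 : Fin 3)
  · exact contDiff_apply ℝ ℝ (2 : Fin 3)

/-- `v ↦ ±(1, v)` is smooth (survivor for `gnomonicQuat` itself: ✓`T4WilsonPathInsert.contDiff_gnomonicQuat`). [folklore] -/
theorem contDiff_gnoLetter {n : WithTop ℕ∞} (ε : Bool) : ContDiff ℝ n (gnoLetter ε) := by
  show ContDiff ℝ n (fun v => (if ε then (1 : ℝ) else -1) • gnomonicQuat v)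
  exact (contDiff_const (c := (if ε then (1 : ℝ) else -1))).smul contDiff_gnomonicQuat'

/-- `v ↦ ±(1, v)` is measurable. [folklore] -/
theorem measurable_gnoLetter (ε : Bool) : Measurable (gnoLetter ε) :=
  (contDiff_gnoLetter (n := 0) ε).continuous.measurable

omit [NeZero L] in
/-- `gnomonicPoint a ε` is measurable in the coordinates. [folklore] -/
theorem measurable_gnomonicPoint (a : ℍ) (ε : GnoSign L) : Measurable (gnomonicPoint (L := L) a ε) := by
  refine measurable_const.prodMk (Measurable.prodMk (Measurable.prodMk (Measurable.prodMk ?_ ?_) ?_) ?_)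
  · exact (measurable_gnoLetter _).comp (measurable_fst.comp measurable_fst)
  · exact (measurable_gnoLetter _).comp (measurable_snd.comp measurable_fst)
  · exact (measurable_gnoLetter _).comp (measurable_fst.comp measurable_snd)
  · exact measurable_pi_lambda _ fun f => (measurable_gnoLetter _).comp ((measurable_pi_apply f).comp (measurable_snd.comp measurable_snd))

/-! ## §4 The gnomonic density and the Euler weight -/

/-- THE GNOMONIC DENSITY of the ring's letters: `∏_{x,y,z} ρ · ∏_f ρ`. [folklore] -/
def gnoDensity (η : GnoCoord L) : ℝ :=
  gnomonicWeight η.1.1 * gnomonicWeight η.1.2 * gnomonicWeight η.2.1 * piWeight η.2.2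

/-- The TRANSVERSE one-letter Euler weight `w_⊥(v) = 4(v₁² + v₂²)/(1+|v|²)` (letters `x, y`; the full weight `w(v) = 4|v|²/(1+|v|²)` of `z` and the
followers is w2 g57's ✓`Gnomonic.gnomonicW`, the density ✓`Gnomonic.gnomonicWeight` ∕ `piWeight`). [folklore] -/
def gnoWtr (v : Fin 3 → ℝ) : ℝ := 4 * (v 1 ^ 2 + v 2 ^ 2) / (1 + ∑ i, v i ^ 2)

/-- THE EULER WEIGHT `W` of the ring (memo §2′): `(2α)·ρ + D_{dilated}ρ·η = (2α − W)·ρ`. [folklore] -/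
def gnoW (η : GnoCoord L) : ℝ :=
  gnoWtr η.1.1 + gnoWtr η.1.2 + gnomonicW η.2.1 + ∑ f, gnomonicW (η.2.2 f)

/-- `0 ≤ w_⊥(v) ≤ 4`. [folklore] -/
theorem gnoWtr_nonneg_le (v : Fin 3 → ℝ) : 0 ≤ gnoWtr v ∧ gnoWtr v ≤ 4 := by
  have hs : v 1 ^ 2 + v 2 ^ 2 ≤ ∑ i, v i ^ 2 := by
    rw [Fin.sum_univ_three]; nlinarith [sq_nonneg (v 0)]
  have h0 : 0 < 1 + ∑ i, v i ^ 2 := by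
    have := Finset.sum_nonneg fun i (_ : i ∈ Finset.univ) => sq_nonneg (v i); linarith
  refine ⟨by rw [gnoWtr]; positivity, ?_⟩
  rw [gnoWtr, div_le_iff₀ h0]
  nlinarith [sq_nonneg (v 1), sq_nonneg (v 2)]

/-- `0 ≤ W ≤ 4·(3 + |Fol L|)`. [folklore] -/
theorem gnoW_nonneg_le (η : GnoCoord L) : 0 ≤ gnoW η ∧ gnoW η ≤ 4 * (3 + (Fintype.card (Fol L) : ℝ)) := by
  obtain ⟨a1, a2⟩ := gnoWtr_nonneg_le η.1.1
  obtain ⟨b1, b2⟩ := gnoWtr_nonneg_le η.1.2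
  obtain ⟨c1, c2⟩ := gnomonicW_nonneg_le η.2.1
  have d1 : 0 ≤ ∑ f, gnomonicW (η.2.2 f) := Finset.sum_nonneg fun f _ => (gnomonicW_nonneg_le _).1
  have d2 : ∑ f, gnomonicW (η.2.2 f) ≤ ∑ _f : Fol L, (4 : ℝ) := Finset.sum_le_sum fun f _ => (gnomonicW_nonneg_le _).2
  rw [Finset.sum_const, Finset.card_univ, nsmul_eq_mul] at d2
  refine ⟨by rw [gnoW]; linarith, ?_⟩
  rw [gnoW]; linarith

end Summit.QuantumFields.YangMills.Theorems.SwapVirialDeficit.BlowUpRing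

end
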